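import Mathlib.MeasureTheory.Function.LpSeminorm.CompareExp
import Literature.Analysis.FluidPDE.TsaiLocalPressure
import Literature.Analysis.FluidPDE.StokesInteriorEstimate
import HarnessLib

/-!
# Tools for Tsai's bootstrap (§3.2): Hölder on balls, polynomial-growth bookkeeping, the body
  force of Leray's system, and the Stokes estimate for profiles

Analysis/FluidPDE support file (theorems only) for the decomposition of the named fact
`Literature.Analysis.FluidPDE.tsai1998_lemma32` (Tsai 1998, **Lemma 3.2**). Tsai's bootstrap
(pp. 37–39) iterates the interior `L^r` estimate (3.2) for the Stokes system
`νΔU − ∇P = F`, `F = aU + a(y·∇)U + (U·∇)U`, `div U = 0` and Sobolev's imbedding on shrinking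
concentric balls `B(y₀, 1) ⊃ B(y₀, 1/2) ⊃ …`, keeping track of the growth of every local norm in
the centre `|y₀|`. This file supplies the three ingredients that are used at every step:

* **Hölder on balls** (`eLpNorm_ball_le_mul_eLpNorm`, `eLpNorm_norm_mul_norm_le_measure`): lowering the
  exponent on a ball costs a power of its volume, which does not depend on the centre; products are
  estimated by `eLpNorm_smul_le_mul_eLpNorm` with explicit Hölder triples (`holderTriple_two_six`;
  `(3, 6, 2)` is the tree's `holderTriple_three_six_two` / Mathlib's `ENNReal.HolderTriple.of_toReal`).
* **Polynomial growth in the centre**: all bounds are of the form `K (1 + |x₀|)^m`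
  (`ENNReal.ofReal (K * (1 + ‖x₀‖) ^ m)`), closed under sums, products and constants
  (`ofReal_poly_add_le`, `ofReal_poly_mul`, …).
* **The body force** `F = aU + a(y·∇)U + (U·∇)U` of a Leray profile: `νΔU − ∇P = F`
  (`IsLerayProfile.body_force_eq`), and
  `‖F‖_{L^p(B(x₀,R))} ≤ |a| ‖U‖_p + |a| (|x₀| + R) ‖DU‖_p + ‖DU‖_{q₁} ‖U‖_{q₂}`, `1/p = 1/q₁ + 1/q₂`
  (`IsLerayProfile.eLpNorm_bodyForce_le`; Tsai p. 38:
  "`‖F‖_{3/2,B₁} ≤ C(‖U‖_{2,B₁} + |y₀| ‖∇U‖_{2,B₁} + ‖U‖_{6,B₁} ‖∇U‖_{2,B₁})`").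
* **The Stokes estimate for profiles** (`IsLerayProfile.stokes_estimate`): the named fact
  `stokes_interior_Lr_estimate` (`StokesInteriorEstimate`; Tsai's (3.2)) applied to
  `(v, π) = (U, P − c)`.

Everything is proved; no definitions, no named facts (the Stokes estimate enters as a hypothesis
`(hSt : stokes_interior_Lr_estimate)`).

## References

* T.-P. Tsai, *On Leray's self-similar solutions of the Navier–Stokes equations satisfying local
  energy estimates*, Arch. Rational Mech. Anal. 143 (1998), §3.2 (pp. 37–39) [Tsai1998].
-/

noncomputable section

open MeasureTheory Set Function Filter Topology InnerProductSpace Metric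
open scoped RealInnerProductSpace Laplacian ContDiff ENNReal NNReal

namespace Literature.Analysis.FluidPDE

section Holder

/-- `(2, 6, 3/2)` is a Hölder triple: `1/2 + 1/6 = 2/3` (from Mathlib's
`Real.HolderTriple.ennrealOfReal`). [folklore] -/
theorem holderTriple_two_six : ENNReal.HolderTriple 2 6 (ENNReal.ofReal (3 / 2)) := by
  have h : ENNReal.HolderTriple (ENNReal.ofReal 2) (ENNReal.ofReal 6) (ENNReal.ofReal (3 / 2)) :=
    Real.HolderTriple.ennrealOfReal ⟨by norm_num, by norm_num, by norm_num⟩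
  rwa [ENNReal.ofReal_ofNat, ENNReal.ofReal_ofNat] at h

end Holder

section Balls

/-- **Lowering the exponent on a ball**: for `s ≤ s'`,
`‖f‖_{L^s(B(x₀,R))} ≤ ‖f‖_{L^{s'}(B(x₀,R))} |B(0,R)|^{1/s − 1/s'}` (Hölder; the volume factor
does not depend on the centre). [folklore] -/
theorem eLpNorm_ball_le_mul_eLpNorm {G : Type*} [NormedAddCommGroup G] {f : (EuclideanSpace ℝ (Fin 3)) → G}
    (hf : AEStronglyMeasurable f volume) {s s' : ℝ≥0∞} (hss' : s ≤ s') (x₀ : (EuclideanSpace ℝ (Fin 3))) (R : ℝ) :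
    eLpNorm f s (volume.restrict (ball x₀ R)) ≤
      eLpNorm f s' (volume.restrict (ball x₀ R)) *
        (volume (ball (0 : (EuclideanSpace ℝ (Fin 3))) R)) ^ (1 / s.toReal - 1 / s'.toReal) := by
  have h := eLpNorm_le_eLpNorm_mul_rpow_measure_univ hss' (hf.restrict (s := ball x₀ R))
  rwa [Measure.restrict_apply_univ, Measure.addHaar_ball_center] at h

/-- The volume factor `|B(0,R)|^e` is finite for `e ≥ 0`. [folklore] -/
theorem volume_ball_rpow_lt_top (R : ℝ) {e : ℝ} (he : 0 ≤ e) :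
    (volume (ball (0 : (EuclideanSpace ℝ (Fin 3))) R)) ^ e < ⊤ :=
  ENNReal.rpow_lt_top_of_nonneg he measure_ball_lt_top.ne

/-- **Hölder for a product of norms on any measure**: if `(q₁, q₂, p)` is a Hölder triple then
`‖ |g| |f| ‖_{L^p} ≤ ‖g‖_{L^{q₁}} ‖f‖_{L^{q₂}}`. [folklore] -/
theorem eLpNorm_norm_mul_norm_le_measure {G₁ G₂ : Type*} [NormedAddCommGroup G₁] [NormedAddCommGroup G₂]
    {μ : Measure (EuclideanSpace ℝ (Fin 3))} {g : (EuclideanSpace ℝ (Fin 3)) → G₁} {f : (EuclideanSpace ℝ (Fin 3)) → G₂} (hg : AEStronglyMeasurable g μ)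
    (hf : AEStronglyMeasurable f μ) {q₁ q₂ p : ℝ≥0∞} [ENNReal.HolderTriple q₁ q₂ p] :
    eLpNorm (fun x => ‖g x‖ * ‖f x‖) p μ ≤ eLpNorm g q₁ μ * eLpNorm f q₂ μ := by
  have h := eLpNorm_smul_le_mul_eLpNorm (p := q₁) (q := q₂) (r := p) hf.norm hg.norm (μ := μ)
  rw [eLpNorm_norm, eLpNorm_norm] at h
  refine le_trans (le_of_eq ?_) h
  refine eLpNorm_congr_ae (Eventually.of_forall fun x => ?_)
  simp only [Pi.smul_apply', smul_eq_mul]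

end Balls

/-! ### Polynomial growth in the centre -/

section Poly

/-- Monotonicity of `(1 + t)^m` in `m` for `t ≥ 0`. [folklore] -/
theorem one_add_pow_le_pow_of_le {t : ℝ} (ht : 0 ≤ t) {m m' : ℕ} (h : m ≤ m') :
    (1 + t) ^ m ≤ (1 + t) ^ m' :=
  pow_le_pow_right₀ (by linarith) h

/-- Sum of two polynomial bounds. [folklore] -/
theorem ofReal_poly_add_le {K₁ K₂ t : ℝ} (hK₁ : 0 ≤ K₁) (hK₂ : 0 ≤ K₂) (ht : 0 ≤ t) (m₁ m₂ : ℕ) :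
    ENNReal.ofReal (K₁ * (1 + t) ^ m₁) + ENNReal.ofReal (K₂ * (1 + t) ^ m₂) ≤
      ENNReal.ofReal ((K₁ + K₂) * (1 + t) ^ max m₁ m₂) := by
  rw [← ENNReal.ofReal_add (by positivity) (by positivity)]
  refine ENNReal.ofReal_le_ofReal ?_
  have h1 := one_add_pow_le_pow_of_le ht (le_max_left m₁ m₂)
  have h2 := one_add_pow_le_pow_of_le ht (le_max_right m₁ m₂)
  nlinarith [mul_le_mul_of_nonneg_left h1 hK₁, mul_le_mul_of_nonneg_left h2 hK₂]

/-- Product of two polynomial bounds. [folklore] -/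
theorem ofReal_poly_mul {K₁ K₂ t : ℝ} (hK₁ : 0 ≤ K₁) (ht : 0 ≤ t) (m₁ m₂ : ℕ) :
    ENNReal.ofReal (K₁ * (1 + t) ^ m₁) * ENNReal.ofReal (K₂ * (1 + t) ^ m₂) =
      ENNReal.ofReal ((K₁ * K₂) * (1 + t) ^ (m₁ + m₂)) := by
  rw [← ENNReal.ofReal_mul (by positivity), pow_add]
  ring_nf

/-- A finite `ℝ≥0∞` constant times a polynomial bound. [folklore] -/
theorem const_mul_ofReal_poly {C : ℝ≥0∞} (hC : C ≠ ⊤) (K t : ℝ) (m : ℕ) :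
    C * ENNReal.ofReal (K * (1 + t) ^ m) = ENNReal.ofReal ((C.toReal * K) * (1 + t) ^ m) := by
  conv_lhs => rw [← ENNReal.ofReal_toReal hC]
  rw [← ENNReal.ofReal_mul ENNReal.toReal_nonneg, mul_assoc]

/-- Raising the exponent of a polynomial bound. [folklore] -/
theorem ofReal_poly_le_of_le {K t : ℝ} (hK : 0 ≤ K) (ht : 0 ≤ t) {m m' : ℕ} (h : m ≤ m') :
    ENNReal.ofReal (K * (1 + t) ^ m) ≤ ENNReal.ofReal (K * (1 + t) ^ m') :=
  ENNReal.ofReal_le_ofReal (mul_le_mul_of_nonneg_left (one_add_pow_le_pow_of_le ht h) hK)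

/-- A constant is a polynomial bound of degree `0`. [folklore] -/
theorem ofReal_le_ofReal_poly {K t : ℝ} (hK : 0 ≤ K) (ht : 0 ≤ t) (m : ℕ) :
    ENNReal.ofReal K ≤ ENNReal.ofReal (K * (1 + t) ^ m) := by
  refine ENNReal.ofReal_le_ofReal ?_
  have : (1 : ℝ) ≤ (1 + t) ^ m := one_le_pow₀ (by linarith)
  nlinarith

/-- `t · K (1+t)^m ≤ K (1+t)^{m+1}` and `(t + R) K (1+t)^m ≤ max(1,R) K (1+t)^{m+1}`-type absorption:
`(t + R) ≤ max 1 R * (1 + t)`. [folklore] -/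
theorem add_le_max_one_mul_one_add {t : ℝ} (ht : 0 ≤ t) (R : ℝ) :
    t + R ≤ max 1 R * (1 + t) := by
  rcases le_or_gt R 1 with h | h
  · rw [max_eq_left h]; linarith
  · rw [max_eq_right h.le]; nlinarith

end Poly

/-! ### The body force `F = aU + a(y·∇)U + (U·∇)U` -/

section BodyForce

variable {ν a : ℝ} {U : (EuclideanSpace ℝ (Fin 3)) → (EuclideanSpace ℝ (Fin 3))} {P : (EuclideanSpace ℝ (Fin 3)) → ℝ}

/-- **Leray's system as a Stokes system**: `νΔU − ∇P = F := aU + a(y·∇)U + (U·∇)U`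
(Tsai 1998, p. 37: "Our situation is `νΔU − ∇P = F`, `div U = 0`,
`F(y) = aU + a(y·∇)U + (U·∇)U`"). [cite: Tsai1998, §3.2 (pp. 37–38)] -/
theorem IsLerayProfile.body_force_eq (hprof : IsLerayProfile ν a U P) (x : (EuclideanSpace ℝ (Fin 3))) :
    ν • (Δ U) x - gradient P x = a • U x + a • fderiv ℝ U x x + convect U U x := by
  have hx := hprof.profile_eq x
  rw [← sub_eq_zero, ← neg_eq_zero, ← hx]
  abel

/-- The same with the pressure normalised by a constant, `π = P − c` (`∇π = ∇P`).
[cite: Tsai1998, §3.2 (pp. 37–38)] -/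
theorem IsLerayProfile.body_force_eq_sub_const (hprof : IsLerayProfile ν a U P) (c : ℝ) (x : (EuclideanSpace ℝ (Fin 3))) :
    ν • (Δ U) x - gradient (fun y => P y - c) x = a • U x + a • fderiv ℝ U x x + convect U U x := by
  have hg : gradient (fun y => P y - c) x = gradient P x := by simp only [gradient, fderiv_sub_const]
  rw [hg, hprof.body_force_eq x]

/-- **`L^p` bound for the body force on a ball** (Tsai 1998, p. 38:
"`‖F‖_{3/2,B₁} ≤ C(‖U‖_{2,B₁} + |y₀| ‖∇U‖_{2,B₁} + ‖U‖_{6,B₁}·‖∇U‖_{2,B₁})`"): for `U ∈ C¹`,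
`1 ≤ p` and a Hölder triple `(q₁, q₂, p)`,
`‖aU + a(y·∇)U + (U·∇)U‖_{L^p(B(x₀,R))} ≤ |a| ‖U‖_p + |a| (|x₀| + R) ‖DU‖_p + ‖DU‖_{q₁} ‖U‖_{q₂}`
(all norms on `B(x₀, R)`; `|y| ≤ |x₀| + R` there). [cite: Tsai1998, §3.2 (p. 38)] -/
theorem eLpNorm_bodyForce_le (hU : ContDiff ℝ 1 U) (a : ℝ) (x₀ : (EuclideanSpace ℝ (Fin 3))) {R : ℝ} (hR : 0 ≤ R)
    {p q₁ q₂ : ℝ≥0∞} (hp : 1 ≤ p) [ENNReal.HolderTriple q₁ q₂ p] :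
    eLpNorm (fun x => a • U x + a • fderiv ℝ U x x + convect U U x) p (volume.restrict (ball x₀ R)) ≤
      ENNReal.ofReal |a| * eLpNorm U p (volume.restrict (ball x₀ R)) +
        ENNReal.ofReal (|a| * (‖x₀‖ + R)) *
          eLpNorm (fun x => fderiv ℝ U x) p (volume.restrict (ball x₀ R)) +
        eLpNorm (fun x => fderiv ℝ U x) q₁ (volume.restrict (ball x₀ R)) *
          eLpNorm U q₂ (volume.restrict (ball x₀ R)) := by
  set μ := (volume : Measure (EuclideanSpace ℝ (Fin 3))).restrict (ball x₀ R) with hμ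
  have hUc : Continuous U := hU.continuous
  have hDUc : Continuous fun x => fderiv ℝ U x := hU.continuous_fderiv one_ne_zero
  have hm1 : AEStronglyMeasurable (fun x => a • U x) μ := (hUc.const_smul a).aestronglyMeasurable
  have hm2 : AEStronglyMeasurable (fun x => a • fderiv ℝ U x x) μ :=
    ((hDUc.clm_apply continuous_id).const_smul a).aestronglyMeasurable
  have hm3 : AEStronglyMeasurable (convect U U) μ := (hDUc.clm_apply hUc).aestronglyMeasurable
  -- term 1
  have t1 : eLpNorm (fun x => a • U x) p μ = ENNReal.ofReal |a| * eLpNorm U p μ := by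
    have : (fun x => a • U x) = a • U := rfl
    rw [this, eLpNorm_const_smul, Real.enorm_eq_ofReal_abs]
  -- term 2: `‖a DU(x) x‖ ≤ |a| (|x₀| + R) ‖DU(x)‖` on the ball
  have t2 : eLpNorm (fun x => a • fderiv ℝ U x x) p μ ≤
      ENNReal.ofReal (|a| * (‖x₀‖ + R)) * eLpNorm (fun x => fderiv ℝ U x) p μ := by
    have hbd : ∀ᵐ x ∂μ, ‖a • fderiv ℝ U x x‖ ≤ (|a| * (‖x₀‖ + R)) * ‖fderiv ℝ U x‖ := by
      rw [hμ, ae_restrict_iff' measurableSet_ball]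
      refine Eventually.of_forall fun x hx => ?_
      rw [mem_ball, dist_eq_norm] at hx
      have hxn : ‖x‖ ≤ ‖x₀‖ + R := by
        calc ‖x‖ = ‖(x - x₀) + x₀‖ := by rw [sub_add_cancel]
          _ ≤ ‖x - x₀‖ + ‖x₀‖ := norm_add_le _ _
          _ ≤ R + ‖x₀‖ := by gcongr
          _ = ‖x₀‖ + R := add_comm _ _
      rw [norm_smul, Real.norm_eq_abs, mul_assoc]
      gcongr
      calc ‖fderiv ℝ U x x‖ ≤ ‖fderiv ℝ U x‖ * ‖x‖ := ContinuousLinearMap.le_opNorm _ _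
        _ ≤ ‖fderiv ℝ U x‖ * (‖x₀‖ + R) := by gcongr
        _ = (‖x₀‖ + R) * ‖fderiv ℝ U x‖ := mul_comm _ _
    calc eLpNorm (fun x => a • fderiv ℝ U x x) p μ
        ≤ eLpNorm (fun x => (|a| * (‖x₀‖ + R)) * ‖fderiv ℝ U x‖) p μ := eLpNorm_mono_ae_real hbd
      _ = ENNReal.ofReal (|a| * (‖x₀‖ + R)) * eLpNorm (fun x => fderiv ℝ U x) p μ := by
          have : (fun x => (|a| * (‖x₀‖ + R)) * ‖fderiv ℝ U x‖) =
              (|a| * (‖x₀‖ + R)) • fun x => ‖fderiv ℝ U x‖ := rfl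
          rw [this, eLpNorm_const_smul, eLpNorm_norm, Real.enorm_eq_ofReal (by positivity)]
  -- term 3: `‖DU(x)(U x)‖ ≤ ‖DU(x)‖ ‖U(x)‖`, then Hölder
  have t3 : eLpNorm (convect U U) p μ ≤ eLpNorm (fun x => fderiv ℝ U x) q₁ μ * eLpNorm U q₂ μ := by
    calc eLpNorm (convect U U) p μ ≤ eLpNorm (fun x => ‖fderiv ℝ U x‖ * ‖U x‖) p μ :=
          eLpNorm_mono_real fun x => by
            rw [convect_apply]; exact ContinuousLinearMap.le_opNorm _ _
      _ ≤ eLpNorm (fun x => fderiv ℝ U x) q₁ μ * eLpNorm U q₂ μ :=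
          eLpNorm_norm_mul_norm_le_measure hDUc.aestronglyMeasurable hUc.aestronglyMeasurable
  calc eLpNorm (fun x => a • U x + a • fderiv ℝ U x x + convect U U x) p μ
      ≤ eLpNorm (fun x => a • U x + a • fderiv ℝ U x x) p μ + eLpNorm (convect U U) p μ :=
        eLpNorm_add_le (hm1.add hm2) hm3 hp
    _ ≤ (eLpNorm (fun x => a • U x) p μ + eLpNorm (fun x => a • fderiv ℝ U x x) p μ) +
          eLpNorm (convect U U) p μ := by
        gcongr; exact eLpNorm_add_le hm1 hm2 hp
    _ ≤ _ := by rw [t1]; gcongr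

end BodyForce

/-! ### The Stokes estimate for profiles -/

section Stokes

variable {ν a : ℝ} {U : (EuclideanSpace ℝ (Fin 3)) → (EuclideanSpace ℝ (Fin 3))} {P : (EuclideanSpace ℝ (Fin 3)) → ℝ}

/-- **The interior Stokes estimate for a Leray profile** (Tsai's (3.2) applied to
`(v, π) = (U, P − c)`, `f = F = aU + a(y·∇)U + (U·∇)U`): for `1 < r < ∞`, `R > 0` there is `C`
(from the named fact `stokes_interior_Lr_estimate`) with
`‖D²U‖_{L^r(B(x₀,R))} + ‖∇P‖_{L^r(B(x₀,R))} ≤ C (‖F‖_{L^r(B(x₀,2R))} + ‖U‖_{L^r(B(x₀,2R))}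
  + ‖DU‖_{L^r(B(x₀,2R))} + ‖P − c‖_{L^r(B(x₀,2R))})` for every centre `x₀` and constant `c`.
[cite: Tsai1998, (3.2) p. 37] -/
theorem IsLerayProfile.stokes_estimate (hSt : stokes_interior_Lr_estimate)
    (hprof : IsLerayProfile ν a U P) (hU : ContDiff ℝ ∞ U) (hν : 0 < ν) {r : ℝ≥0∞} (hr : 1 < r)
    (hr' : r < ⊤) {R : ℝ} (hR : 0 < R) :
    ∃ C : ℝ≥0, ∀ (x₀ : (EuclideanSpace ℝ (Fin 3))) (c : ℝ),
      eLpNorm (fun x => iteratedFDeriv ℝ 2 U x) r (volume.restrict (ball x₀ R)) +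
          eLpNorm (fun x => fderiv ℝ P x) r (volume.restrict (ball x₀ R)) ≤
        C * (eLpNorm (fun x => a • U x + a • fderiv ℝ U x x + convect U U x) r
              (volume.restrict (ball x₀ (2 * R))) +
            eLpNorm U r (volume.restrict (ball x₀ (2 * R))) +
            eLpNorm (fun x => fderiv ℝ U x) r (volume.restrict (ball x₀ (2 * R))) +
            eLpNorm (fun x => P x - c) r (volume.restrict (ball x₀ (2 * R)))) := by
  obtain ⟨C, hC⟩ := stokes_interior_Lr_estimate_ball hSt hν hr hr' hR
  refine ⟨C, fun x₀ c => ?_⟩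
  have hU2 : ContDiff ℝ 2 U := hU.of_le (by norm_cast)
  have hP1 : ContDiff ℝ 1 P := (hprof.contDiff_two_pressure (hU.of_le (by norm_cast))).of_le one_le_two
  have hπ1 : ContDiff ℝ 1 fun x => P x - c := hP1.sub contDiff_const
  have hdiv : ∀ x ∈ ball x₀ (2 * R), VectorCalculus.divergence U x = 0 := fun x _ => hprof.divFree x
  have h := hC x₀ U (fun x => P x - c) hU2 hπ1 hdiv
  have hF : (fun x => ν • (Δ U) x - gradient (fun y => P y - c) x) =
      fun x => a • U x + a • fderiv ℝ U x x + convect U U x :=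
    funext (hprof.body_force_eq_sub_const c)
  have hDπ : (fun x => fderiv ℝ (fun y => P y - c) x) = fun x => fderiv ℝ P x :=
    funext fun x => fderiv_sub_const c
  rw [hF, hDπ] at h
  exact h

end Stokes

end Literature.Analysis.FluidPDE

end
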